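import Literature.NumberTheory.GaloisCohomology.Howard2004.InertLocalPairingSymmetricProofs
import Literature.NumberTheory.GaloisCohomology.Howard2004.RelaxedSelmerSelfAnnihilatorProofs
import Literature.NumberTheory.GaloisCohomology.Howard2004.DualityDatumLocalTwoSocleProofs
import Literature.Algebra.Module.LagrangianSubmodulesDeltaTransfer
import HarnessLib

/-!
# Howard 2004, Prop. 1.5.9 at an inert Kolyvagin prime: the Lagrangian TRANSFER `htransfer` from the local
# hypotheses — the Galois-side instance of the module-theoretic Lemmas 1.5.7–1.5.8 (proofs file)

Topic `NumberTheory/GaloisCohomology/Howard2004`. THEOREMS ONLY: no definition, no named fact, no instance, no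
notation, no `sorry`. Cell `pub/bsd-print-x9`, print leaf G87
`Literature.NumberTheory.GaloisCohomology.Howard2004.thm161_dvrKolyvaginBound` (Howard Thm. 1.6.1); seat
`bsd-line-x9-p1-w4` g16, brick (LAGR-LOC-INST).

SOURCE / WHY. B. Howard, *The Heegner point Kolyvagin system*, Compositio Math. **140** (2004) = arXiv:1202.6340,
Lemma 1.5.7, Lemma 1.5.8, Prop. 1.5.9 (p. 10 L105 – p. 11 L13).  The tree splits Prop. 1.5.9 into (a) the MODULE
THEORY over a DVR `𝒪` (`Literature/Algebra/Module/LagrangianSubmodulesDeltaTransfer.forall_pow_smul_eq_zero_of_lagrangian`,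
x9-p1-w4 g15: for a symmetric non-degenerate `𝒪`-bilinear `B : V × V → P` with `P` of rank-one socle, `V = V_f ⊕ V_tr`
with `V_f, V_tr ≅ (𝒪/ϖ^k)²` isotropic, and `A = A^⟂`: «`ϖ^λ` kills `A ∩ V_f` and the lengths match ⟹ `ϖ^{λ'}` kills
`A ∩ V_tr`»), (b) the GALOIS-SIDE assembly `StubLocalizationTransferProofs.smul_le_ker_of_smul_le_ker_of_transfer`
(x9-p1-w3 g14), which takes (a)'s conclusion at `V = H¹(K_q, T^{(k)})`, `A = loc_q H¹_{𝓕^q(n)}`, `V_f = H¹_f(K_q, T)`,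
`V_tr = H¹_tr(K_q, T)` as the hypothesis-function `htransfer`, and (c) the Galois inputs of (a) at an inert Kolyvagin
prime `q`: `hA` (`RelaxedSelmerSelfAnnihilatorProofs`), `hnd` (`RelaxedSelmerLagrangianCountProofs`), `hsymm`
(`InertLocalPairingSymmetricProofs`), `hP` (`DualityDatumLocalTwoSocleProofs`), `hf` (`UnramifiedIsotropy`), `htr`
(`TransverseIsotropyProofs`).  THIS FILE performs (c) ⟹ `htransfer`: it realises Howard's `R`-valued local pairing
`⟨x, a⟩_q = inv_q(x ∪_e transport_q a)` as the `𝒪`-bilinear form `B'(x, a) = coord(x ∪_e T_q a) ∈ R` on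
`V = H¹(K_q, T)` (the functorial `𝒪`-module structure `galoisCohomology.moduleH1`; `coord` = the coordinates of
`DualityDatumLocalTwoSocleProofs`, `T_q = transport_q ∘ (σ q = q ▸ ·)`) with values in the LEVEL RING `R` viewed as an
`𝒪`-module, and applies (a).

WHAT IS PROVED.
* §1 `coord`-bookkeeping as theorems on the readings (`eq_of_forall_lam_mul_eq`, `exists_coord`: uniqueness,
  additivity, `R`-semilinearity, vanishing) and a private copy of `scalarMapH1_algebraMap` (the `𝒪`-action on `H¹` is
  the `R`-action through `𝒪 → R`).
* §2 **`DualityDatum.forall_pow_smul_eq_zero_of_inert_local`** (= `htransfer`): under the hypotheses of the six input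
  files (Poitou–Tate family `inv`, readings `(λ, exp)`, dualizing family, `Θ` bijective, H.4-structure `𝓕` with `𝓡`
  relaxed at `q`, trivial local actions at `q`, `Γ_{K_q} = ⋃ σ₀^j Λ_q`, (φI)/(φΛ)/(δ), `IsPrimaryTorsion p R`, odd torsion)
  plus a DVR `𝒪` with uniformiser `ϖ` acting on `T` through `R` (`IsScalarTower 𝒪 R T`), `2 ∈ 𝒪ˣ`, and «the
  `ϖ`-torsion of `R` is a line over `𝒪`»: for `𝒪`-submodules `SA, SV_f, SV_tr` of `H¹(K_q, T)` with underlying groups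
  `loc_q H¹_𝓡(K, T)`, `H¹_ur(K_q, T)`, `H¹_tr(K_q, T)`, `SV_f ⊕ SV_tr = H¹` (`IsCompl`) and `SV_f, SV_tr ≃ (𝒪/ϖ^k)²`:
  `(∀ a ∈ SA ⊓ SV_f, ϖ^λ a = 0) → 2λ' + ℓ(SA ⊓ SV_f) = 2λ + ℓ(SA ⊓ SV_tr) → ∀ a ∈ SA ⊓ SV_tr, ϖ^{λ'} a = 0` — literally the
  `htransfer` binder of `smul_le_ker_of_smul_le_ker_of_transfer` at `𝓕 := 𝓕(n)`, `𝒯 := 𝓣`, the scalar ring `𝒪`.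

NOT HERE: the hypotheses themselves (READ data for the level ring; the local arithmetic of `ℓ ∈ 𝓛_k`; `IsCompl` and the
two `(𝒪/ϖ^k)²`-structures = Prop. 1.1.9, x9-p1-w3's lane; the Poitou–Tate named fact); `thm161_dvrKolyvaginBound` is NOT
proved; no summit statement is proved; the Birch–Swinnerton-Dyer conjecture is not proved by any of this.
References: [Howard2004HeegnerKolyvagin] Lemma 1.5.6–1.5.8, Prop. 1.5.9, §1.3 H.4, Prop. 1.1.9; [MilneADT2006] I Cor. 2.3, Thm. 4.10.
-/

set_option autoImplicit false

noncomputable section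

open CategoryTheory Function NumberField IsDedekindDomain Field
open scoped NumberField

namespace Literature.NumberTheory.GaloisCohomology.Howard2004

open Literature.NumberTheory.GaloisRepresentations
open Literature.NumberTheory.GaloisRepresentations.DiscreteGaloisModule

variable {K : Type} [Field K] [NumberField K] {M : Type} [AddCommGroup M] [TopologicalSpace M]
  [DiscreteTopology M] {R : Type} [CommRing R] [Module R M] [TopologicalSpace R] [DiscreteTopology R]
  {p : ℕ} [Fact p.Prime] [Algebra ℤ_[p] R]

/-! ## §1 The `𝒪`-action through `𝒪 → R`, and coordinates of `H²(K_q, R(1))` -/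

omit [TopologicalSpace R] [DiscreteTopology R] in
/-- **The `𝒪`-action on `H¹` is the `R`-action through `𝒪 → R`**: `H¹(c •) = H¹((algebraMap c) •)` when
`c • m = algebraMap c • m` on the module (`IsScalarTower 𝒪 R M`) — a local copy, for an arbitrary `IsScalarLinear 𝒪`
witness, of `galoisCohomology.scalarMapH1_algebraMap` (`KolyvaginSystemRescalingProofs`, not imported here).
[cite: Howard2004HeegnerKolyvagin, §1 conventions and §1.6 (arXiv p. 11 L33–38: the level `T^{(k)}` over `R_k = R/𝔪^{e_k}`)] [cite: SerreGaloisCohomology1997, I §2.2] -/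
private theorem scalarMapH1_algebraMap'
    {𝒪 : Type} [CommRing 𝒪] [Algebra 𝒪 R] [Module 𝒪 M] [IsScalarTower 𝒪 R M] {F : Type} [Field F]
    (τ : DiscreteGaloisModule F M) (h𝒪 : τ.IsScalarLinear 𝒪) (hR : τ.IsScalarLinear R) (c : 𝒪)
    (x : galoisCohomology τ 1) :
    galoisCohomology.scalarMapH1 τ h𝒪 c x = galoisCohomology.scalarMapH1 τ hR (algebraMap 𝒪 R c) x := by
  obtain ⟨φ, rfl⟩ := oneCocycleClass_surjective _ x
  rw [galoisCohomology.scalarMapH1_oneCocycleClass, galoisCohomology.scalarMapH1_oneCocycleClass]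
  refine congrArg _ (Subtype.ext (ContinuousMap.ext fun σ => ?_))
  rw [galoisCohomology.scalarCocycle_apply, galoisCohomology.scalarCocycle_apply, algebraMap_smul]

namespace DualityDatum

variable {cd : ConjugationDatum K} {ρ : DiscreteGaloisModule K M} [Finite M] [Finite R]
  (D : DualityDatum p cd ρ R) {k : ℕ}
  (lam : R →+ ZMod (p ^ k))
  (hlam : ∀ (z : ℤ_[p]) (r : R), lam (algebraMap ℤ_[p] R z * r) = PadicInt.toZModPow k z * lam r)
  (exp : ZMod (p ^ k) →+ MuCarrier K (p ^ k))
  (hexp : ∀ (g : absoluteGaloisGroup K) (x : ZMod (p ^ k)),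
    exp (cyclotomicCharacterModPow K p k g * x) = mu K (p ^ k) g (exp x))

omit [NumberField K] [TopologicalSpace R] [DiscreteTopology R] [Fact (Nat.Prime p)] [Algebra ℤ_[p] R] [Finite M]
  [Finite R] in
/-- Coordinates are unique: `λ(c b) = λ(c' b)` for all `b` forces `c = c'` (dualizing family).
[cite: Howard2004HeegnerKolyvagin, §1.3 H.4 (arXiv p. 7 L78–82: «perfect»)] -/
theorem eq_of_forall_lam_mul_eq (lam : R →+ ZMod (p ^ k)) (exp : ZMod (p ^ k) →+ MuCarrier K (p ^ k))
    {ι : Type} (r : ι → R) (hbij : Bijective fun x : R => fun i : ι => exp (lam (r i * x)))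
    {c c' : R} (h : ∀ b : R, lam (c * b) = lam (c' * b)) : c = c' := by
  rw [← sub_eq_zero]
  refine eq_zero_of_forall_lam_mul_eq_zero lam exp r hbij _ fun i => ?_
  rw [mul_sub, map_sub, sub_eq_zero, mul_comm (r i) c, mul_comm (r i) c', h]

omit [Finite M] in
include hlam in
/-- **A coordinate function exists**: a function `coord : H²(K_v, R(1)) → R` with `ι H²(exp ∘ λ_b) z = λ(coord(z) · b)`
for all `b` (choice over `exists_forall_reading_eq_lam_mul`); it is additive, `R`-semilinear (`coord(H²(a•) z) = a · coord z`),
and detects zero when `ι` is injective. [cite: Howard2004HeegnerKolyvagin, §1.3 H.4 (arXiv p. 7 L78–82: «⟨ , ⟩_v … → R»)] [cite: MilneADT2006, Ch. I Cor. 2.3] -/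
theorem exists_coord (hRk : ∀ x : R, (p ^ k) • x = 0) {ι : Type} [Finite ι] (r : ι → R)
    (hbij : Bijective fun x : R => fun i : ι => exp (lam (r i * x))) (v : Place K)
    (ι₀ : galoisCohomology ((mu K (p ^ k)).toLocal v) 2 →+ ZMod (p ^ k)) (hι₀ : Injective ι₀) :
    ∃ coord : galoisCohomology (D.twistOne.toLocal v) 2 → R,
      (∀ z b, ι₀ (cohomologyMap (D.expLamLocalHom (lamMul lam b) (lamMul_semilinear lam hlam b) exp hexp v) 2 z) =
          lam (coord z * b)) ∧
      (∀ z z', coord (z + z') = coord z + coord z') ∧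
      (∀ (a : R) z, coord (galoisCohomology.scalarMap (D.twistOne.toLocal v)
          (isScalarLinear_toLocal D.isScalarLinear_twistOne v) 2 a z) = a * coord z) ∧
      ∀ z, coord z = 0 ↔ z = 0 := by
  choose coord hcoord using fun z => D.exists_forall_reading_eq_lam_mul lam hlam exp hexp hRk r hbij v ι₀ z
  refine ⟨coord, hcoord, fun z z' => ?_, fun a z => ?_, fun z => ⟨fun h0 => ?_, fun h0 => ?_⟩⟩
  · refine eq_of_forall_lam_mul_eq lam exp r hbij fun b => ?_
    rw [add_mul, map_add, ← hcoord, ← hcoord, ← hcoord, ← map_add]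
    exact congrArg ι₀ (map_add _ z z')
  · refine eq_of_forall_lam_mul_eq lam exp r hbij fun b => ?_
    rw [← hcoord, D.cohomologyMap_expLam_lamMul_scalarMap_two lam hlam exp hexp v b a z, hcoord]
    congr 1
    ring
  · refine D.eq_of_forall_reading_eq lam hlam exp hexp r hbij v ι₀ hι₀ z 0 fun i => ?_
    rw [hcoord, h0, zero_mul, map_zero]
    exact ((congrArg ι₀ (map_zero _)).trans (map_zero ι₀)).symm
  · refine eq_of_forall_lam_mul_eq lam exp r hbij fun b => ?_
    rw [zero_mul, map_zero, ← hcoord, h0]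
    exact (congrArg ι₀ (map_zero _)).trans (map_zero ι₀)

/-! ## §2 `htransfer` at an inert Kolyvagin prime -/

include hlam hexp in
/-- **Howard 2004, Prop. 1.5.9 at an inert Kolyvagin prime — the Lagrangian transfer `htransfer` from the local
hypotheses.**  See the file header for the setting.  With `V = H¹(K_q, T)` as an `𝒪`-module (`moduleH1` for the DVR
`𝒪` acting through the level ring `R`), `𝒪`-submodules `SA`, `SV_f`, `SV_tr` whose underlying groups are
`loc_q H¹_𝓡(K, T)`, `H¹_ur(K_q, T)`, `H¹_tr(K_q, T)`, `IsCompl SV_f SV_tr`, and `SV_f, SV_tr ≃ₗ[𝒪] (𝒪/ϖ^k)²`: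
if `ϖ^λ` kills `SA ⊓ SV_f` and `2λ' + ℓ_𝒪(SA ⊓ SV_f) = 2λ + ℓ_𝒪(SA ⊓ SV_tr)` then `ϖ^{λ'}` kills `SA ⊓ SV_tr`.
PROOF: `forall_pow_smul_eq_zero_of_lagrangian` (Lemmas 1.5.7–1.5.8) for the `𝒪`-bilinear form
`B'(x, a) = coord(x ∪_e T_q a) : V × V → R`, whose hypotheses are the six landed Galois inputs: `hA`
(`mem_map_localization_selmerGroup_iff_forall_localCup_cast_eq_zero`), `hnd`
(`eq_zero_of_forall_localCup_transportH1_cast_eq_zero`), `hsymm` (`localCup_transportH1_cast_comm`), `hf`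
(`localCup_transportH1_eq_zero_of_mem_unramifiedSubgroup`), `htr` (`localCup_transportH1_eq_zero_of_mem_transverseCondition`),
`hP` (the socle of `R` over `𝒪`).
[cite: Howard2004HeegnerKolyvagin, Prop. 1.5.9 with Lemmas 1.5.6–1.5.8 (arXiv:1202.6340 p. 10 L80 – p. 11 L13)] [cite: MilneADT2006, Ch. I Cor. 2.3 and Thm. 4.10] -/
theorem forall_pow_smul_eq_zero_of_inert_local
    {𝒪 : Type} [CommRing 𝒪] [IsDomain 𝒪] [IsDiscreteValuationRing 𝒪] [Algebra 𝒪 R] [Module 𝒪 M]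
    [IsScalarTower 𝒪 R M] {ϖ : 𝒪} (hϖ : Irreducible ϖ) (h2 : IsUnit (2 : 𝒪))
    (hsoc : ∀ a b : R, ϖ • a = 0 → ϖ • b = 0 → a ≠ 0 → ∃ c : 𝒪, b = c • a)
    (hρ𝒪 : ρ.IsScalarLinear 𝒪) (hρ : ρ.IsScalarLinear R)
    -- the finite module and the readings
    (hn : ∀ m : M, (p ^ k) • m = 0) (hRk : ∀ x : R, (p ^ k) • x = 0) (hRp : IsPrimaryTorsion p R)
    (inv : LocalInvariants K (p ^ k)) (hPT : inv.SumLocalTermEqZero) (hSC : inv.SelmerComplement)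
    (hperf : inv.IsPerfect) (hΘ : Bijective (D.toTateDual lam hlam exp hexp))
    {ι : Type} [Finite ι] (r : ι → R) (hbij : Bijective fun x : R => fun i : ι => exp (lam (r i * x)))
    -- the global structure relaxed at the inert `q`
    (S : Finset (Place K))
    (hS : ∀ v : HeightOneSpectrum (𝓞 K), (Sum.inr v : Place K) ∉ S →
      ((p ^ k : ℕ) : 𝓞 K) ∉ v.asIdeal ∧ GaloisRep.IsUnramifiedAt v ρ)
    (𝓕 𝓡 : SelmerStructure ρ) {q : HeightOneSpectrum (𝓞 K)} (hq : cd.σ • q = q)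
    (hqS : (Sum.inr q : Place K) ∈ S) (h𝓡S : 𝓡.IsUnramifiedOutside S)
    (hrel : 𝓡 (Sum.inr q) = ⊤)
    (hoff : ∀ v : HeightOneSpectrum (𝓞 K), v ≠ q → 𝓡 (Sum.inr v) = 𝓕 (Sum.inr v))
    (horth : ∀ v : HeightOneSpectrum (𝓞 K), v ≠ q → D.IsSelfOrthogonalAt 𝓕 v)
    (hstab : ∀ v : HeightOneSpectrum (𝓞 K), v ≠ q → ∀ i, ∀ a ∈ 𝓕 (Sum.inr v),
      galoisCohomology.scalarMapH1 (ρ.toLocal (Sum.inr v)) (isScalarLinear_toLocal hρ (Sum.inr v)) (r i) a ∈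
        𝓕 (Sum.inr v))
    (hinf : ∀ (w : InfinitePlace K) (c : galoisCohomology ρ 1),
      galoisCohomology.localization ρ (Sum.inl w) 1 c = 0)
    -- the local arithmetic at `q`
    (ℓ : ℕ) (jbar : AlgebraicClosure K →+* ℂ)
    (htriv : ∀ (g : absoluteGaloisGroup (q.adicCompletion K)) (x : M), GaloisRep.toLocal q ρ g x = x)
    (htriv' : ∀ (g : absoluteGaloisGroup ((cd.σ • q).adicCompletion K)) (x : M), GaloisRep.toLocal (cd.σ • q) ρ g x = x)
    (htrivTw : ∀ (g : absoluteGaloisGroup (q.adicCompletion K)) (x : M), GaloisRep.toLocal q (cd.twist ρ) g x = x)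
    (hp : ∀ x : M, ∃ n : ℕ, p ^ n • x = 0) {N : ℕ} (hN : Odd N) (hRN : ∀ r : R, N • r = 0)
    (hI : ∀ g ∈ absInertia (q.adicCompletion K), cd.φ q g ∈ absInertia ((cd.σ • q).adicCompletion K))
    (hφ : ∀ h ∈ localRingClassSubgroup ℓ jbar q, cd.φ q h ∈ localRingClassSubgroup ℓ jbar (cd.σ • q))
    (σ₀ : absoluteGaloisGroup (q.adicCompletion K))
    (hcyc : ∀ σ, ∃ j : ℕ, (σ₀ ^ j)⁻¹ * σ ∈ localRingClassSubgroup ℓ jbar q)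
    (hφI : ∀ g : absoluteGaloisGroup (q.adicCompletion K), ∃ i ∈ absInertia (q.adicCompletion K),
      (hq ▸ cd.φ q g : absoluteGaloisGroup (q.adicCompletion K)) = i * g)
    (hφΛ : ∀ g : absoluteGaloisGroup (q.adicCompletion K), ∃ l ∈ localRingClassSubgroup ℓ jbar q,
      (hq ▸ cd.φ q g : absoluteGaloisGroup (q.adicCompletion K)) = l * g⁻¹)
    (hδ : ∀ u w : M, D.e u (ρ (cd.δ q) w) = D.e w (ρ (cd.δ q) u)) :
    letI := galoisCohomology.moduleH1 (ρ.toLocal (Sum.inr q)) (isScalarLinear_toLocal hρ𝒪 (Sum.inr q))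
    ∀ (SA SVf SVtr : Submodule 𝒪 (galoisCohomology (ρ.toLocal (Sum.inr q)) 1)),
      SA.toAddSubgroup = 𝓡.selmerGroup.map (galoisCohomology.localization ρ (Sum.inr q) 1) →
      SVf.toAddSubgroup = unramifiedSubgroup (GaloisRep.toLocal q ρ) 1 →
      SVtr.toAddSubgroup = transverseCondition p ρ ℓ jbar q →
      IsCompl SVf SVtr →
      ∀ {kk : ℕ}, Nonempty (↥SVf ≃ₗ[𝒪] (Fin 2 → 𝒪 ⧸ Ideal.span {ϖ ^ kk})) →
        Nonempty (↥SVtr ≃ₗ[𝒪] (Fin 2 → 𝒪 ⧸ Ideal.span {ϖ ^ kk})) →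
      ∀ {lam₁ lam₂ : ℕ}, (∀ a ∈ SA ⊓ SVf, ϖ ^ lam₁ • a = 0) →
        2 * (lam₂ : ℕ∞) + Module.length 𝒪 ↥(SA ⊓ SVf) = 2 * (lam₁ : ℕ∞) + Module.length 𝒪 ↥(SA ⊓ SVtr) →
        ∀ a ∈ SA ⊓ SVtr, ϖ ^ lam₂ • a = 0 := by
  letI := galoisCohomology.moduleH1 (ρ.toLocal (Sum.inr q)) (isScalarLinear_toLocal hρ𝒪 (Sum.inr q))
  intro SA SVf SVtr hSA hSVf hSVtr hc kk hef hetr lam₁ lam₂ hlam₁ hlen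
  obtain ⟨ef⟩ := hef
  obtain ⟨etr⟩ := hetr
  -- the coordinate function on `H²(K_q, R(1))`
  obtain ⟨coord, hcoord, hadd, hsmulR, hzero⟩ :=
    D.exists_coord lam hlam exp hexp hRk r hbij (Sum.inr q) (inv (Sum.inr q)) (hperf q).1.1
  -- shorthand for the transported class at the inert `q` (a local notation, not a definition)
  have hT_add : ∀ y y' : galoisCohomology (ρ.toLocal (Sum.inr q)) 1,
      cd.transportH1 ρ q (hq.symm ▸ (y + y') : galoisCohomology (ρ.toLocal (Sum.inr (cd.σ • q))) 1) =
        cd.transportH1 ρ q (hq.symm ▸ y : galoisCohomology (ρ.toLocal (Sum.inr (cd.σ • q))) 1) +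
          cd.transportH1 ρ q (hq.symm ▸ y' : galoisCohomology (ρ.toLocal (Sum.inr (cd.σ • q))) 1) :=
    cd.transportH1_cast_add ρ hq
  -- `𝒪`-scalars act through `R` on `H¹(K_q, T)`
  have hsmulV : ∀ (c : 𝒪) (x : galoisCohomology (ρ.toLocal (Sum.inr q)) 1),
      c • x = galoisCohomology.scalarMapH1 (ρ.toLocal (Sum.inr q)) (isScalarLinear_toLocal hρ (Sum.inr q))
        (algebraMap 𝒪 R c) x := fun c x =>
    scalarMapH1_algebraMap' (ρ.toLocal (Sum.inr q)) (isScalarLinear_toLocal hρ𝒪 (Sum.inr q))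
      (isScalarLinear_toLocal hρ (Sum.inr q)) c x
  -- the `𝒪`-bilinear form `B'(x, a) = coord (x ∪_e T_q a)`
  let B' : galoisCohomology (ρ.toLocal (Sum.inr q)) 1 →ₗ[𝒪] galoisCohomology (ρ.toLocal (Sum.inr q)) 1 →ₗ[𝒪] R :=
    LinearMap.mk₂ 𝒪
      (fun x a => coord (D.localCup (Sum.inr q) x
        (cd.transportH1 ρ q (hq.symm ▸ a : galoisCohomology (ρ.toLocal (Sum.inr (cd.σ • q))) 1))))
      (fun x x' a => by
        change coord _ = coord _ + coord _
        rw [map_add, AddMonoidHom.add_apply, hadd])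
      (fun c x a => by
        change coord _ = c • coord _
        rw [hsmulV, D.localCup_scalarMapH1_left (Sum.inr q) (isScalarLinear_toLocal hρ (Sum.inr q)), hsmulR,
          Algebra.smul_def])
      (fun x a a' => by
        change coord _ = coord _ + coord _
        rw [hT_add, map_add, hadd])
      (fun c x a => by
        change coord _ = c • coord _
        rw [hsmulV, cd.transportH1_cast_scalarMapH1 ρ hρ hq,
          D.localCup_scalarMapH1_right (Sum.inr q) (isScalarLinear_toLocal hρ (Sum.inr q))
            (isScalarLinear_twist_toLocal cd hρ (Sum.inr q)), hsmulR, Algebra.smul_def])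
  have hB' : ∀ x a, B' x a = coord (D.localCup (Sum.inr q) x
      (cd.transportH1 ρ q (hq.symm ▸ a : galoisCohomology (ρ.toLocal (Sum.inr (cd.σ • q))) 1))) := fun _ _ => rfl
  -- membership dictionary
  have memA : ∀ x, x ∈ SA ↔ x ∈ 𝓡.selmerGroup.map (galoisCohomology.localization ρ (Sum.inr q) 1) := fun x => by
    rw [← Submodule.mem_toAddSubgroup, hSA]
  have memF : ∀ x, x ∈ SVf ↔ x ∈ unramifiedSubgroup (GaloisRep.toLocal q ρ) 1 := fun x => by
    rw [← Submodule.mem_toAddSubgroup, hSVf]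
    exact Iff.rfl
  have memT : ∀ x, x ∈ SVtr ↔ x ∈ transverseCondition p ρ ℓ jbar q := fun x => by
    rw [← Submodule.mem_toAddSubgroup, hSVtr]
    exact Iff.rfl
  -- the hypotheses of the Lagrangian algebra
  have hdecomp : ∀ x : galoisCohomology (ρ.toLocal (Sum.inr q)) 1,
      ∃ f : galoisCohomology (ρ.toLocal (Sum.inr q)) 1, f ∈ unramifiedSubgroup (GaloisRep.toLocal q ρ) 1 ∧
        ∃ t : galoisCohomology (ρ.toLocal (Sum.inr q)) 1, t ∈ transverseCondition p ρ ℓ jbar q ∧ x = f + t := by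
    intro x
    have hx : x ∈ SVf ⊔ SVtr := by rw [hc.sup_eq_top]; exact Submodule.mem_top
    obtain ⟨f, hf, t, ht, rfl⟩ := Submodule.mem_sup.1 hx
    exact ⟨f, (memF f).1 hf, t, (memT t).1 ht, rfl⟩
  have hsymm' : ∀ x y, B' x y = B' y x := fun x y => by
    rw [hB', hB', D.localCup_transportH1_cast_comm hRp ℓ jbar hq htriv htriv' htrivTw hp hN hRN hI hφ σ₀ hcyc hφI
      hφΛ hδ hdecomp x y]
  have hnd' : ∀ x, (∀ y, B' x y = 0) → x = 0 := fun x hx =>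
    D.eq_zero_of_forall_localCup_transportH1_cast_eq_zero lam hlam exp hexp hn hΘ inv hperf hq x fun a =>
      (hzero _).1 (by rw [← hB']; exact hx a)
  have hf' : ∀ x ∈ SVf, ∀ y ∈ SVf, B' x y = 0 := fun x hx y hy => by
    rw [hB', D.localCup_transportH1_eq_zero_of_mem_unramifiedSubgroup hRp q hI ((memF x).1 hx)
      ((cast_mem_unramifiedSubgroup_iff ρ hq.symm y).2 ((memF y).1 hy))]
    exact (hzero 0).2 rfl
  have htr' : ∀ x ∈ SVtr, ∀ y ∈ SVtr, B' x y = 0 := fun x hx y hy => by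
    rw [hB', D.localCup_transportH1_eq_zero_of_mem_transverseCondition ℓ jbar q htriv htriv' htrivTw hp hN hRN σ₀ hcyc
      hφ ((memT x).1 hx) ((cast_mem_transverseCondition_iff ρ p ℓ jbar hq.symm y).2 ((memT y).1 hy))]
    exact (hzero 0).2 rfl
  have hA' : ∀ x, x ∈ SA ↔ ∀ a ∈ SA, B' x a = 0 := fun x => by
    rw [memA, D.mem_map_localization_selmerGroup_iff_forall_localCup_cast_eq_zero lam hlam exp hexp hn hρ inv hPT hSC
      (fun v => (hperf v).1.1) hΘ r hbij S hS 𝓕 𝓡 hq hqS h𝓡S hrel hoff horth hstab hinf x]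
    refine ⟨fun h a ha => ?_, fun h a ha => ?_⟩
    · rw [hB', h a ((memA a).1 ha)]; exact (hzero 0).2 rfl
    · exact (hzero _).1 ((hB' x a).symm.trans (h a ((memA a).2 ha)))
  exact Literature.Algebra.Module.forall_pow_smul_eq_zero_of_lagrangian hϖ hsoc B' hsymm' hnd' hc ef etr hf' htr' h2
    SA hA' hlam₁ hlen

end DualityDatum

end Literature.NumberTheory.GaloisCohomology.Howard2004

end
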